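import Summits.CriticalPhenomena.Ising3DConformalLimit.Theses.HyperoctahedralRP
import Summits.CriticalPhenomena.Ising3DConformalLimit.Theses.IsingEuclidUpgrade
import Summits.CriticalPhenomena.Ising3DConformalLimit.Theses.AnomalousForcesInteraction
import Summits.CriticalPhenomena.Ising3DConformalLimit.Theses.WeylWindow
import Literature.Probability.LatticeModels.CriticalUrsellFourSign
import Literature.Probability.LatticeModels.PointwiseScalingLimitScaleCovariant
import Literature.Probability.LatticeModels.SourcedDoubleCurrentsSwitching
import Literature.Probability.LatticeModels.IntersectionSecondMoment
import Literature.Probability.LatticeModels.SusceptibilityMeanFieldBound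
import HarnessLib
import HarnessLib.Audit

/-!
# Line `four-current-coset-robustness` for crux `IsingEuclidUpgradeR4NonGaussian`
# (stmt-CriticalPhenomena-0636)

CHECKED SKELETON (crux-plan; planner-cruxplan-stmt-CriticalPhenomena-0636-four-current-coset-r-0,
2026-08-15). Idea card `Cruxes/IsingEuclidUpgradeR4NonGaussian/Ideas/four-current-coset-robustness.md`
(triage r1: pass ×3), planned — as all three triagers asked — as ONE programme with the dispatcher
card `free-covariance-delta-dichotomy`: {`Δ < 3/4`: fat step + meeting robustness} ∪
{`Δ ≥ 3/4`: the anomalous branch, item stmt-CriticalPhenomena-2601 `GaussianLimitIsFree`}.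

The crux (shared by 25 route files, one term; primary copy here `HyperoctahedralRP`):
`∀ ρ S, (∀ δ ∈ Ioc 0 1, 0 < ρ δ) → HasPointwiseScalingLimit (criticalCorr 3) ρ S →
IsNondegenerateTwoPoint S → HasNontrivialU4 S` — non-triviality of every non-degenerate pointwise
scaling limit of the critical Ising₃ correlators.

THE LINE (finite volume throughout: every probabilistic object is a current of the free box graph
`freeBoxGraph 3 L` at `β_c(3)`; the volume `Λ_L ↑ ℤ³` is taken AFTER the mesh `δ` is fixed, exactly
as in the tree file `CriticalUrsellFourSign` — so no infinite-volume current measure is needed).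
Write `x̃ᵢ = [xᵢ/δ]`, `G_L = ⟨σσ⟩⁰_{Λ_L,β_c}`, `P² = P^{x̃₀x̃₁,x̃₂x̃₃}_{Λ_L}[x̃₀ ↔ x̃₂]` (`twoCurrentMeet`,
the quantity of the PROVED box identity `U₄,Λ_L = −2 G_L G_L · P²`, `connectedFour_free_box_eq`,
ADC21 (3.11)) and `P⁴ = P^{x̃₀x̃₁,∅}_{Λ_L} ⊗ P^{x̃₂x̃₃,∅}_{Λ_L}[x̃₀ ↔ x̃₂ in n₁+n₃+n₂+n₄]`
(`fourCurrentMeet`; the conditioning event is CONNECTION IN THE SUM OF ALL FOUR currents, triage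
r1-3 sharpening, which contains `{x̃₀ ↔ x̃₂ in n₁+n₂}`).
* LAMPERTI (tree, PROVED — `HasPointwiseScalingLimit.exists_rpow_scale_mem_Icc`): every
  non-degenerate limit is scale covariant on non-coincident configurations with some `Δ ∈ [1/2,1]`.
* FAT STEP, `Δ < 3/4` (card move (1); "genuinely free" — triage r1-1/2/3), cut in two stubs:
  `stub_secondMomentBox` — the second-moment inequality `P⁴ ≥ M₁²/M₂` for two INDEPENDENT sourced
  double currents with DISJOINT source pairs in a box (first moment exact by switching, second moment
  by the tree bound ADC21 Prop. A.3; the shared-source version is the tree file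
  `IntersectionSecondMoment`), and `stub_momentRatioLowerBound` — under the crux hypotheses with
  exponent `Δ < 3/4` the box moment ratio `M₁²/M₂` at `x̃ = [x/δ]` stays `≥ c(x) > 0` for small `δ`
  and large `L` (power count `(E N)²/E N² ≍ L³G(L)²/B(L)`, bounded below iff `2(2−η) > 3`; the
  two-sided all-direction control of `G` at scale `1/δ` is the GIFT of the limit hypothesis).
* THIN STEP = MEETING ROBUSTNESS `stub_meetingRobustness` (card move (2), the Transfer `C⁺ = MR`, the
  OPEN HEART): `P² ≥ c · P⁴` at one non-coincident quadruple, i.e. given that the two FAT clusters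
  `C_{n₁+n₃}(x̃₀)`, `C_{n₂+n₄}(x̃₂)` are glued, the THIN pair `(n₁, n₂)` — conditionally a uniform
  element of the parity coset of the edge-copy multigraph of `n₁+n₃` (resp. `n₂+n₄`), independent
  fair coins conditioned on the boundary — still connects `x̃₀` to `x̃₂` with conditional probability
  `≥ c`. (`P⁴`-marginal of `(n₁,n₂)` is `P^{x̃₀x̃₁} ⊗ P^{x̃₂x̃₃}`, so `P²` IS the four-current
  probability of `{x̃₀ ↔ x̃₂ in n₁+n₂}`.)
* COMPOSITION (kernel-checked, `IsingEuclidUpgradeR4NonGaussian_of`): normalise the limit (item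
  stmt-CriticalPhenomena-4739 `WeylWindow.LimitNormalisation`, BY NAME: `S' = S·𝟙_{NC}`, translation
  invariant — needed only to feed item 2601's hypothesis list; `U₄^{S'} = U₄^{S}` on `NC` by
  uniqueness of limits, `limitConnectedFour_eq_of_limits`); Lamperti gives `Δ ∈ [1/2,1]`;
  if `Δ < 3/4`: fat × thin ⇒ `P² ≥ c·c' > 0` for small `δ`, large `L` (`twoCurrentMeet_lower`) ⇒
  box identity + `Λ_L ↑ ℤ³` ⇒ the Disproof's ρ-free lattice target `LatticeU4RatioPositive`
  (restated here VERBATIM with `latU4`, so that the skeleton does not import the living workfile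
  `Disproof.lean`; `latticeU4RatioPositive_of_twoCurrentMeet_lower`, PROVED here) ⇒ `U₄^{S'} ≢ 0` by
  `hasNontrivialU4_of_latticeU4RatioPositive` (= the Disproof's §C.1 `of_latticeU4RatioPositive`,
  proof copied, sorry-free; stated per limit so that EXACTLY ONE theorem of this file concludes the
  crux decl by name); if `Δ ≥ 3/4`: a `U₄`-free limit would be scale covariant with `Δ = 1/2` by item
  stmt-CriticalPhenomena-2601 `AnomalousForcesInteraction.GaussianLimitIsFree` (BY NAME) — contradiction.

DISPROOF USED (`Cruxes/IsingEuclidUpgradeR4NonGaussian/Disproof.lean`, cdisprove gen 2, verdict NOT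
REFUTED; read, §C restated rather than imported): §A `false_without_nondegeneracy` — honoured: `IsNondegenerateTwoPoint` is consumed
by `of_latticeU4RatioPositive` (turns `P² ≥ c` into `U₄^S ≤ −2c S₂S₂ < 0`) and by Lamperti;
`false_without_latticeClause(_moebius)` (GFF witness) — honoured: all three stubs are statements about
random currents of the nearest-neighbour model (switching, insertion tolerance), void for a
generalised free field; `iff_withoutPositivity` — positivity of `ρ` is only divided by; §B
`U4_nonpos`/`abs_U4_le_two_mul`/`iff_exists_neg` — the line produces ONE configuration with
`U₄^S < 0` through `p = P² ∈ [c c', 1]`; §B.5 Wick dichotomy — not needed (the anomalous branch uses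
item 2601 instead), but it calibrates MR: in a Wick world below `Δ = 3/4` the fat step survives, so MR
is exactly what fails there; §C `LatticeU4RatioPositive` — IS the line's endpoint
(`of_latticeU4RatioPositive` concludes); §D `cruxAt_iff_vacuous_of_five_le` — honoured: the `d = 3`
input is explicit in `stub_momentRatioLowerBound` (`3 − 4Δ > 0`); §E.2 (JSP prose) — consistent: at
`Δ = 1/2` with OS + rotations the limit would be free and MR must fail; MR is a lattice statement.
No `Negative/` lemma has landed for this crux (nothing to import); `ledger negatives` (7 entries) has
none on clause (iii).
-/

noncomputable section

open Filter Topology Set Function MeasureTheory Finset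
open Literature.Probability.LatticeModels Literature.Probability.Percolation
open scoped symmDiff

namespace Summit.CriticalPhenomena.Ising3DConformalLimit.Cruxes.IsingEuclidUpgradeR4NonGaussian.FourCurrentCosetRobustness

set_option linter.unusedVariables false

/-! ## Objects of the line (all finite-volume: the free box `Λ_L ⊂ ℤ³` at `β_c(3)`) -/

/-- The lattice point `x̃ᵢ = [xᵢ/δ]` of a macroscopic configuration `x`. [folklore] -/
abbrev lat (δ : ℝ) (x : Fin 4 → EuclideanSpace ℝ (Fin 3)) (i : Fin 4) : Site 3 :=
  latticeApprox δ (x i)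

/-- The free-boundary box two-point function `G_L(u,v) = ⟨σ_uσ_v⟩⁰_{Λ_L,β_c(3)}`. [folklore] -/
def boxG (L : ℕ) (u v : Site 3) : ℝ :=
  isingTwoPoint (zdGraph 3) (box 3 L) (criticalBeta 3) 0 .free u v

/-- `P² = P^{{a}∆{b},{c}∆{e}}_{Λ_L,β_c}[a ↔ c]`: the probability that the clusters of the two sourced
currents `n₁` (`∂n₁ = {a,b}`) and `n₂` (`∂n₂ = {c,e}`) are glued (`a ↔ c` in `n₁ + n₂`) — the
quantity of the box identity `U₄,Λ_L(a,b,c,e) = −2 G_L(a,b) G_L(c,e) · P²`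
(`connectedFour_free_box_eq`). [cite: AizenmanDuminilCopinAnnals2021, eq. (3.11)] -/
def twoCurrentMeet (L : ℕ) (a b c e : Site 3) : ℝ :=
  (sourcedDoubleCurrentLaw 3 L (criticalBeta 3) ({a} ∆ {b}) ({c} ∆ {e})).real (openConn a c)

/-- The FOUR-CURRENT law `P^{ab,∅}_{Λ_L} ⊗ P^{ce,∅}_{Λ_L}` of `((n₁,n₃),(n₂,n₄))`: two independent
sourced double currents of the free box graph, pairing `(n₁,n₃)`, `(n₂,n₄)` as in ADC21 (3.13).
[cite: AizenmanDuminilCopinAnnals2021, §3.2 eq. (3.13)] -/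
def fourCurrentLaw (L : ℕ) (a b c e : Site 3) :
    Measure ((Current (freeBoxGraph 3 L) × Current (freeBoxGraph 3 L)) ×
      (Current (freeBoxGraph 3 L) × Current (freeBoxGraph 3 L))) :=
  (doubleCurrentMeasure (freeBoxGraph 3 L) (criticalBeta 3) (boxSources 3 L ({a} ∆ {b})) ∅).prod
    (doubleCurrentMeasure (freeBoxGraph 3 L) (criticalBeta 3) (boxSources 3 L ({c} ∆ {e})) ∅)

/-- `MEET₄`: `a ↔ c` in the (lifted) trace of `n₁ + n₃ + n₂ + n₄` — the two fat clusters
`C_{n₁+n₃}(a)`, `C_{n₂+n₄}(c)` are glued (triage r1-3: conditioning on connection in the sum of all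
four currents, which contains `{a ↔ c in n₁+n₂}`). [cite: AizenmanDuminilCopinAnnals2021, §4.2, proof of Lemma 4.4] -/
def FourMeet (L : ℕ) (a c : Site 3) :
    Set ((Current (freeBoxGraph 3 L) × Current (freeBoxGraph 3 L)) ×
      (Current (freeBoxGraph 3 L) × Current (freeBoxGraph 3 L))) :=
  {pq | liftBonds 3 L ((pq.1.1 + pq.1.2) + (pq.2.1 + pq.2.2)).traced ∈ openConn a c}

/-- `P⁴ = P^{ab,∅}_{Λ_L} ⊗ P^{ce,∅}_{Λ_L}[MEET₄]`, the four-current gluing probability. [cite: AizenmanDuminilCopinAnnals2021, §4.2, Lemma 4.4] -/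
def fourCurrentMeet (L : ℕ) (a b c e : Site 3) : ℝ :=
  (fourCurrentLaw L a b c e).real (FourMeet L a c)

/-- The exact one-point density of a sourced double current (switching):
`P^{ab,∅}_{Λ_L}[v ∈ C_{n₁+n₃}(a)] = G_L(a,v)G_L(v,b)/G_L(a,b)`. [cite: AizenmanDuminilCopinAnnals2021, §4.2, proof of Lemma 4.4 (first display)] -/
def threePointRatio (L : ℕ) (a b v : Site 3) : ℝ :=
  boxG L a v * boxG L v b / boxG L a b

/-- FIRST MOMENT `M₁ = E⁴[N_A]` of the number `N_A` of sites of `A` in `C_{n₁+n₃}(a) ∩ C_{n₂+n₄}(c)`: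
`∑_{v ∈ A} (G(a,v)G(v,b)/G(a,b)) · (G(c,v)G(v,e)/G(c,e))`. [cite: AizenmanDuminilCopinAnnals2021, §4.2, proof of Lemma 4.4] -/
def boxMoment₁ (L : ℕ) (a b c e : Site 3) (A : Finset (Site 3)) : ℝ :=
  ∑ v ∈ A, threePointRatio L a b v * threePointRatio L c e v

/-- The two-step (tree) bound of ADC21 Prop. A.3 for a pair of sites:
`B_{ab}(v,w) = G(a,v)G(v,w)G(w,b) + G(a,w)G(w,v)G(v,b)`. [cite: AizenmanDuminilCopinAnnals2021, Appendix A.2, Proposition A.3] -/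
def twoStep (L : ℕ) (a b v w : Site 3) : ℝ :=
  boxG L a v * boxG L v w * boxG L w b + boxG L a w * boxG L w v * boxG L v b

/-- SECOND-MOMENT BOUND `M₂ ≥ E⁴[N_A²]`:
`∑_{v,w ∈ A} (B_{ab}(v,w)/G(a,b)) · (B_{ce}(v,w)/G(c,e))`. [cite: AizenmanDuminilCopinAnnals2021, §4.2, proof of Lemma 4.4 (second display)] -/
def boxMoment₂ (L : ℕ) (a b c e : Site 3) (A : Finset (Site 3)) : ℝ :=
  ∑ v ∈ A, ∑ w ∈ A, (twoStep L a b v w / boxG L a b) * (twoStep L c e v w / boxG L c e)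

/-- Scale covariance with exponent `Δ` on NON-COINCIDENT configurations — the output of the tree's
Lamperti theorem `HasPointwiseScalingLimit.exists_rpow_scale_mem_Icc` (for a normalised family it is
`IsScaleCovariant Δ`, `isScaleCovariant_of_scaleCovariantOn`). [cite: FrancescoMathieuSenechal1997, §4.3.1] -/
def ScaleCovariantOn (Δ : ℝ) (S : CorrFamily 3) : Prop :=
  ∀ (n : ℕ) (c : ℝ), 0 < c → ∀ x ∈ NonCoincident 3 n,
    S n (fun i => c • x i) = c ^ (-(n : ℝ) * Δ) * S n x

/-- The lattice connected four-point function at the mesh-`δ` approximation of `x` (VERBATIM the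
Disproof's `latU4`, restated so that this file does not import the living workfile). [folklore] -/
def latU4 (δ : ℝ) (x : Fin 4 → EuclideanSpace ℝ (Fin 3)) : ℝ :=
  criticalCorr 3 4 (fun i => latticeApprox δ (x i)) -
    (criticalCorr 3 2 ![latticeApprox δ (x 0), latticeApprox δ (x 1)] *
        criticalCorr 3 2 ![latticeApprox δ (x 2), latticeApprox δ (x 3)]
      + criticalCorr 3 2 ![latticeApprox δ (x 0), latticeApprox δ (x 2)] *
        criticalCorr 3 2 ![latticeApprox δ (x 1), latticeApprox δ (x 3)]
      + criticalCorr 3 2 ![latticeApprox δ (x 0), latticeApprox δ (x 3)] *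
        criticalCorr 3 2 ![latticeApprox δ (x 1), latticeApprox δ (x 2)])

/-- **The Disproof's ρ-free LATTICE TARGET (§C, VERBATIM)**: at some non-coincident quadruple `x` and
some `c > 0`, `-U₄^{lat}([x/δ]) ≥ c·⟨σ_{[x₀/δ]}σ_{[x₁/δ]}⟩⟨σ_{[x₂/δ]}σ_{[x₃/δ]}⟩` for all small `δ > 0`
— "the double-current intersection probability at scale `1/δ` stays bounded below" (ADC21 (3.11)).
`Iff.rfl` with `Disproof.LatticeU4RatioPositive`. [cite: AizenmanDuminilCopinAnnals2021, eq. (3.11)] -/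
def LatticeU4RatioPositive : Prop :=
  ∃ x ∈ NonCoincident 3 4, ∃ c : ℝ, 0 < c ∧ ∀ᶠ δ in 𝓝[>] (0:ℝ),
    c * (criticalCorr 3 2 ![latticeApprox δ (x 0), latticeApprox δ (x 1)] *
      criticalCorr 3 2 ![latticeApprox δ (x 2), latticeApprox δ (x 3)]) ≤ - latU4 δ x

/-! ## The registered stubs -/

/-- **STUB 1 — FAT STEP, combinatorial half: the second-moment inequality for two independent
sourced double currents with DISJOINT source pairs in a box (provable now, size M).** For
`a,b,c,e ∈ Λ_L`, `A ⊆ Λ_L`: `P⁴[a ↔ c in n₁+n₃+n₂+n₄] ≥ M₁²/M₂`. Proof = the three displays of ADC21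
Lemma 4.4 with `{o,x},{o,z}` replaced by `{a,b},{c,e}`: (i) `E⁴[N_A] = M₁` — the one-point density
`P^{ab,∅}[v ∈ C_{n₁+n₃}(a)] = G(a,v)G(v,b)/G(a,b)` is EXACT (switching; tree
`tsum_epairWeight_mul_indicator_mem_cluster`), independence of the two pairs; (ii) `E⁴[N_A²] ≤ M₂` —
`P^{ab,∅}[v,w ∈ C_{n₁+n₃}(a)] ≤ B_{ab}(v,w)/G(a,b)` (ADC21 Prop. A.3; tree
`ecurrentSum_empty_mul_tsum_connInd_mul_connInd_le`); (iii) Cauchy–Schwarz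
`P[N ≠ 0] ≥ E[N]²/E[N²]` (tree `Current.tsum_mul_sq_le_tsum_indicator_mul_tsum_sq`), and
`{N_A ≠ 0} ⊆ MEET₄` (a common site of `C_{n₁+n₃}(a)` and `C_{n₂+n₄}(c)` joins `a` to `c` in the union
of the traces; lift with `liftBonds_mem_openConn_iff`). Remaining formal work: the tree's
`IntersectionSecondMoment` is stated for a SHARED source `o` and in un-normalised `ℝ≥0∞` current-sum
form (`ecurrentSum`); transport to `doubleCurrentMeasure`/`isingTwoPoint` of the box via
`isingTwoPoint_free_eq_currentSum_div`, `isingTwoPoint_free_box_eq_boxGraph` (triage r1-1: "the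
disjoint-source variant is the same proof, not yet in tree"). With Lean's `x/0 = 0` the inequality is
trivially true in every degenerate case. [cite: AizenmanDuminilCopinAnnals2021, §4.2 Lemma 4.4 and Appendix A Prop. A.3] -/
theorem stub_secondMomentBox :
    ∀ (L : ℕ) (a b c e : Site 3), a ∈ box 3 L → b ∈ box 3 L → c ∈ box 3 L → e ∈ box 3 L →
      ∀ A : Finset (Site 3), A ⊆ box 3 L →
        boxMoment₁ L a b c e A ^ 2 / boxMoment₂ L a b c e A ≤ fourCurrentMeet L a b c e := by
  sorry

/-- **STUB 2 — FAT STEP, analytic half: below `Δ = 3/4` the moment ratio does not degenerate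
(provable now, size M–L; the `d = 3`-specific input of the line).** Under the crux hypotheses, if the
(automatic) scaling exponent satisfies `Δ < 3/4`, then for EVERY non-coincident quadruple `x` there
are `c > 0` and counting regions `A(δ) ⊂ ℤ³` (intended: the lattice ball of radius `R/δ` around the
configuration, `R ≍ diam x`) with `M₁²/M₂ ≥ c` at `x̃ = [x/δ]` for all small `δ` and then all large
`L`. For fixed `δ` every `G_L` term converges as `L → ∞` (`criticalCorr_wellDefined_holds`), so the
content is the `δ → 0` asymptotics of the infinite-volume sums: with `G(x̃ᵢ,v) = ρ(δ)⁻²(S₂(xᵢ,δv) +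
o(1))` uniformly for `δv` at macroscopic distance from the `xᵢ` (the limit hypothesis; this is the
two-sided, all-direction control of `G` at scale `1/δ` that ADC had to manufacture through regular
scales), the Simon–Lieb/infrared window `c‖v‖⁻² ≤ G ≤ C‖v‖⁻¹` near the sources
(`criticalTwoPoint_bounds_holds`) and scale covariance `S₂(cu) = c^{-2Δ}S₂(u)`: `M₁ ≍ δ^{4Δ−3}`,
generic terms of `M₂ ≍ δ^{8Δ−6}`, and the near-diagonal terms `v ≈ w` of `M₂` are
`δ^{4Δ−3} · ∑_{‖w‖ ≤ R/δ} G(w)² · O(1)`; the bubble-at-scale `∑_{‖w‖ ≤ N} G(w)²` is `O(N³G(N)²)`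
iff `3 − 4Δ > 0`. Multi-scale control WITHOUT Karamata theory (ρ need not even be measurable): the
limit at mesh `1/r` gives the RATIO REGULARITY `G(0,[cq·r])/G(0,[q·r]) → c^{-2Δ}` uniformly for `q`
on the unit sphere and `c` in a compact (local uniformity on a compact annulus of `NC₂` + scale
covariance of `S₂`); chained dyadically from scale `N = R/δ` down to a fixed `r₀` it yields the
Potter-type bound `G(r) ≤ G(N)(r/N)^{-2Δ-ε}` for `r₀ ≤ r ≤ N` with an `ε`-loss per the compounding —
affordable because `3 − 4Δ > 0` is an OPEN condition (bubble `≤ N³G(N)²/(3−4Δ−2ε)`; near-source shells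
`∑_{r ≤ εN} r²G(r) ≤ ε^{3−2Δ−ε'}·N³G(N)`); sites at bounded distance `≤ r₀` from a source carry
`G ≤ 1` and contribute `O(ρ(δ)⁻²) = o(M₁²·δ⁶ρ⁸)` since `Δ < 1`. Whence `M₁²/M₂ ≥ c`. Why it might
fail: only through the uniformity of the ratio regularity in the direction — which local uniform
convergence on the compact annulus supplies. At `Δ = 3/4` the bubble is `∑ 1/r = log N` and the
ratio decays like `1/log(1/δ)` (ADC's marginal case): the threshold is sharp. [cite: AizenmanDuminilCopinAnnals2021, §4.2 Lemma 4.4, §5 (regular scales) and eq. (1.12)]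
[cite: Aizenman1982, §1 and Prop. 5.3 (tree-diagram count L^{4-d})] -/
theorem stub_momentRatioLowerBound :
    ∀ (ρ : ℝ → ℝ) (S : CorrFamily 3) (Δ : ℝ), (∀ δ ∈ Set.Ioc (0:ℝ) 1, 0 < ρ δ) →
      HasPointwiseScalingLimit (criticalCorr 3) ρ S → IsNondegenerateTwoPoint S →
      ScaleCovariantOn Δ S → Δ < 3 / 4 →
      ∀ x ∈ NonCoincident 3 4, ∃ c : ℝ, 0 < c ∧ ∃ A : ℝ → Finset (Site 3),
        ∀ᶠ δ in 𝓝[>] (0:ℝ), ∀ᶠ L : ℕ in atTop,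
          c ≤ boxMoment₁ L (lat δ x 0) (lat δ x 1) (lat δ x 2) (lat δ x 3) (A δ) ^ 2 /
              boxMoment₂ L (lat δ x 0) (lat δ x 1) (lat δ x 2) (lat δ x 3) (A δ) := by
  sorry

/-- **STUB 3 — THIN STEP = MEETING ROBUSTNESS `MR` (the card's Transfer `C⁺`; OPEN, size XL — the
HARDEST stub, the open heart of the line).** Under the crux hypotheses with `Δ < 3/4` there is ONE
non-coincident quadruple `x` and `c > 0` with `P² ≥ c · P⁴` at `x̃ = [x/δ]` for all small `δ` and large
`L`: conditionally on the two FAT clusters `C_{n₁+n₃}(x̃₀)`, `C_{n₂+n₄}(x̃₂)` being glued, the THIN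
pair still joins `x̃₀` to `x̃₂` in `n₁ + n₂` with probability `≥ c` (`P²` is the `P⁴`-probability of
`{x̃₀ ↔ x̃₂ in n₁+n₂}`: the `(n₁,n₂)`-marginal of `P^{ab,∅} ⊗ P^{ce,∅}` is `P^{ab} ⊗ P^{ce}` =
`doubleCurrentMeasure _ _ {a,b} {c,e}`, read on the trace by `sourcedTrace_preimage_openConn`).
WHY EASIER than the crux (card + triage): (i) the conditional law is EXPLICIT — given `m = n₁+n₃`,
`n₁` is a uniform element of the parity coset `{n ≤ m̃ : ∂n = {x̃₀,x̃₁}}` of the edge-copy multigraph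
(independent fair coins on the copies conditioned on the boundary: the combinatorial core of the
switching lemma, `w(n₁)w(n₃) = w(m)∏ C(m_e, n₁,e)`), independently for `(n₂ | n₂+n₄)`, and by
switching `P^{ab,∅}[· | v ∈ C_{n₁+n₃}(a)]` is the law of the sum of two independent sourced currents
`a → v`, `v → b`; so near a contact site the question is finite `𝔽₂`-linear algebra on the local cycle
space; (ii) pairing involutions give free partial robustness (`P_coins[deg_{n₁}(v) ≥ 2 | m] ≥ 1/2`; a
cut vertex of the multigraph between the `a`- and `b`-sides lies on `C_{n₁}(a)` surely); (iii) two
sufficient conditions of different flavour: `RobustCoreDensity` (≈ the single ≥ c·double one-point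
comparison — probably FALSE as an `O(1)` statement by the card's own `d = 1`/Lupu–Werner toy and
`D_HT ≈ 1.73 < 2 − η`, triage r1-1/3: do NOT start there) and the coin-free `BackboneContact`
`P^{ab} ⊗ P^{ce}[backbone(n₁) ∩ backbone(n₂) ≠ ∅] ≥ c` (a common vertex of the two backbones gives
`a ↔ c in n₁+n₂` outright; second-moment problem for Aizenman's backbone with the chain rule — tree
`BackboneChainRule`, `BackboneKernel`, upper bounds proved — whose missing input is a one-point LOWER
bound through the depleted two-point function; triage r1-2: "the coin-free sufficient condition to
stub first", file it with `--supports`). CALIBRATION (why it might fail): given STUBS 1–2, MR is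
EQUIVALENT to the crux below `Δ = 3/4` (Disproof §C), and it must FAIL in any Wick world with
`η < 1/2` (the fat step uses no interaction) — the Ising interaction (`σ² = 1` ⇒ hard-core parity
constraint) enters ONLY through the coset; at `Δ = 1/2` exactly, MR is vacuous-or-false (an
OS-positive rotation-invariant `η = 0` limit would be free by Jost–Schroer–Pohlmeyer, Disproof §E.2),
so its content lives at `Δ ∈ (1/2, 3/4)` ∋ `Δ_σ ≈ 0.518`, where item 2601 is an ALTERNATIVE engine
(Markov inheritance) that this line does not use; numerically `p = −U₄/(2S₂S₂) = O(1)` at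
macroscopic separation (Disproof §F), i.e. MR holds with `c ≈ p`. The shared open heart of cards 2/4/6
is a lower bound on the meeting of two independent SINGLE sourced critical currents on `ℤ³` (triage
r1-2 cross-card note).
[cite: AizenmanDuminilCopinAnnals2021, Lemma 3.3 (switching) and eq. (3.11)]
[cite: Aizenman1982, §3 Lemma 3.2 and §5] [cite: LupuWerner2016, Thm. 1 (arXiv:1511.05524)] -/
theorem stub_meetingRobustness :
    ∀ (ρ : ℝ → ℝ) (S : CorrFamily 3) (Δ : ℝ), (∀ δ ∈ Set.Ioc (0:ℝ) 1, 0 < ρ δ) →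
      HasPointwiseScalingLimit (criticalCorr 3) ρ S → IsNondegenerateTwoPoint S →
      ScaleCovariantOn Δ S → Δ < 3 / 4 →
      ∃ x ∈ NonCoincident 3 4, ∃ c : ℝ, 0 < c ∧
        ∀ᶠ δ in 𝓝[>] (0:ℝ), ∀ᶠ L : ℕ in atTop,
          c * fourCurrentMeet L (lat δ x 0) (lat δ x 1) (lat δ x 2) (lat δ x 3) ≤
            twoCurrentMeet L (lat δ x 0) (lat δ x 1) (lat δ x 2) (lat δ x 3) := by
  sorry

/-! ## Proved glue -/

/-- Eventually (in `L`) the four lattice points and a given finite set lie in the box `Λ_L`. [folklore] -/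
theorem eventually_mem_box (δ : ℝ) (x : Fin 4 → EuclideanSpace ℝ (Fin 3)) (A : Finset (Site 3)) :
    ∀ᶠ L : ℕ in atTop, (∀ i, lat δ x i ∈ box 3 L) ∧ A ⊆ box 3 L := by
  classical
  obtain ⟨L₀, hL₀⟩ := exists_forall_subset_box 3 (A ∪ Finset.univ.image (lat δ x))
  filter_upwards [eventually_ge_atTop L₀] with L hL
  refine ⟨fun i => hL₀ L hL ?_, fun v hv => hL₀ L hL (Finset.mem_union_left _ hv)⟩
  exact Finset.mem_union_right _ (Finset.mem_image_of_mem _ (Finset.mem_univ i))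

/-- **FAT STEP (STUBS 1 + 2)**: below `Δ = 3/4` the four-current gluing probability at scale `1/δ`
is bounded below, for small `δ` and large `L`, at every non-coincident quadruple.
[cite: AizenmanDuminilCopinAnnals2021, §4.2 Lemma 4.4] -/
theorem fourCurrentMeet_lower {ρ : ℝ → ℝ} {S : CorrFamily 3} {Δ : ℝ}
    (hρ : ∀ δ ∈ Set.Ioc (0:ℝ) 1, 0 < ρ δ) (hlim : HasPointwiseScalingLimit (criticalCorr 3) ρ S)
    (hnd : IsNondegenerateTwoPoint S) (hcov : ScaleCovariantOn Δ S) (hΔ : Δ < 3 / 4)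
    {x : Fin 4 → EuclideanSpace ℝ (Fin 3)} (hx : x ∈ NonCoincident 3 4) :
    ∃ c : ℝ, 0 < c ∧ ∀ᶠ δ in 𝓝[>] (0:ℝ), ∀ᶠ L : ℕ in atTop,
      c ≤ fourCurrentMeet L (lat δ x 0) (lat δ x 1) (lat δ x 2) (lat δ x 3) := by
  obtain ⟨c, hc, A, hev⟩ := stub_momentRatioLowerBound ρ S Δ hρ hlim hnd hcov hΔ x hx
  refine ⟨c, hc, ?_⟩
  filter_upwards [hev] with δ hδ
  filter_upwards [hδ, eventually_mem_box δ x (A δ)] with L hL hbox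
  exact hL.trans (stub_secondMomentBox L _ _ _ _ (hbox.1 0) (hbox.1 1) (hbox.1 2) (hbox.1 3)
    (A δ) hbox.2)

/-- **FAT × THIN (STUBS 1–3)**: below `Δ = 3/4` the double-current gluing probability
`P^{x̃₀x̃₁,x̃₂x̃₃}_{Λ_L}[x̃₀ ↔ x̃₂]` is bounded below at one non-coincident quadruple, for small `δ` and
large `L`. [cite: AizenmanDuminilCopinAnnals2021, eq. (3.11)] -/
theorem twoCurrentMeet_lower {ρ : ℝ → ℝ} {S : CorrFamily 3} {Δ : ℝ}
    (hρ : ∀ δ ∈ Set.Ioc (0:ℝ) 1, 0 < ρ δ) (hlim : HasPointwiseScalingLimit (criticalCorr 3) ρ S)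
    (hnd : IsNondegenerateTwoPoint S) (hcov : ScaleCovariantOn Δ S) (hΔ : Δ < 3 / 4) :
    ∃ x ∈ NonCoincident 3 4, ∃ κ : ℝ, 0 < κ ∧ ∀ᶠ δ in 𝓝[>] (0:ℝ), ∀ᶠ L : ℕ in atTop,
      κ ≤ twoCurrentMeet L (lat δ x 0) (lat δ x 1) (lat δ x 2) (lat δ x 3) := by
  obtain ⟨x, hx, c, hc, hev⟩ := stub_meetingRobustness ρ S Δ hρ hlim hnd hcov hΔ
  obtain ⟨c', hc', hev'⟩ := fourCurrentMeet_lower hρ hlim hnd hcov hΔ hx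
  refine ⟨x, hx, c * c', mul_pos hc hc', ?_⟩
  filter_upwards [hev, hev'] with δ hδ hδ'
  filter_upwards [hδ, hδ'] with L hL hL'
  calc c * c' ≤ c * fourCurrentMeet L (lat δ x 0) (lat δ x 1) (lat δ x 2) (lat δ x 3) :=
        mul_le_mul_of_nonneg_left hL' hc.le
    _ ≤ _ := hL

/-- **From the box lower bound to the Disproof's ρ-free LATTICE TARGET** (`Λ_L ↑ ℤ³` after `δ`):
if `P^{x̃₀x̃₁,x̃₂x̃₃}_{Λ_L}[x̃₀ ↔ x̃₂] ≥ κ > 0` for small `δ` and large `L`, then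
`−U₄^{lat}([x/δ]) ≥ 2κ ⟨σσ⟩⟨σσ⟩([x/δ])` for small `δ` — the box identity `U₄,Λ_L = −2G_LG_L·P²`
(`connectedFour_free_box_eq`), Griffiths I for `G_L ≥ 0`, and the box limits
`tendsto_connectedFour_box_criticalBeta` / `criticalCorr_wellDefined_holds`.
[cite: AizenmanDuminilCopinAnnals2021, eq. (3.11)–(3.12)] -/
theorem latticeU4RatioPositive_of_twoCurrentMeet_lower
    (h : ∃ x ∈ NonCoincident 3 4, ∃ κ : ℝ, 0 < κ ∧ ∀ᶠ δ in 𝓝[>] (0:ℝ), ∀ᶠ L : ℕ in atTop,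
      κ ≤ twoCurrentMeet L (lat δ x 0) (lat δ x 1) (lat δ x 2) (lat δ x 3)) :
    LatticeU4RatioPositive := by
  classical
  obtain ⟨x, hx, κ, hκ, hev⟩ := h
  refine ⟨x, hx, 2 * κ, by positivity, ?_⟩
  filter_upwards [hev] with δ hδ
  -- the lattice configuration at mesh `δ`
  set y : Fin 4 → Site 3 := fun i => latticeApprox δ (x i) with hy
  have hmem : (BoundaryCondition.free : BoundaryCondition (Site 3)) ∈
      ({.free, .plus, .minus} : Set (BoundaryCondition (Site 3))) := by simp
  -- box two-point functions converge to the critical ones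
  have hT : ∀ i j : Fin 4, Tendsto (fun L : ℕ => boxG L (y i) (y j)) atTop
      (𝓝 (criticalCorr 3 2 ![y i, y j])) := by
    intro i j
    have h := criticalCorr_wellDefined_holds (d := 3) (by norm_num) 2 ![y i, y j] .free hmem
    refine Tendsto.congr (fun L => ?_) h
    simp only [boxG, isingTwoPoint, spinMonomial_two]
  -- the box connected four-point function converges to `latU4 δ x`
  have hU : Tendsto (fun L : ℕ => connectedFour (isingMeasure (zdGraph 3) (box 3 L) (criticalBeta 3)
      0 .free) spinAt y) atTop (𝓝 (latU4 δ x)) :=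
    tendsto_connectedFour_box_criticalBeta (d := 3) (by norm_num) y
  have hB := ((hT 0 1).mul (hT 2 3)).const_mul (2 * κ)
  -- the inequality in every large box
  have hle : ∀ᶠ L : ℕ in atTop, 2 * κ * (boxG L (y 0) (y 1) * boxG L (y 2) (y 3)) ≤
      -(connectedFour (isingMeasure (zdGraph 3) (box 3 L) (criticalBeta 3) 0 .free) spinAt y) := by
    filter_upwards [hδ, eventually_mem_box δ x ∅] with L hL hbox
    have hb := hbox.1
    have hy4 : y = ![y 0, y 1, y 2, y 3] := by funext i; fin_cases i <;> rfl
    have hid := connectedFour_free_box_eq 3 L (criticalBeta_nonneg 3) (hb 0) (hb 1) (hb 2) (hb 3)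
    rw [hy4, hid]
    simp only [Matrix.cons_val_zero, Matrix.cons_val_one, Matrix.cons_val]
    have hG01 : 0 ≤ boxG L (y 0) (y 1) := isingTwoPoint_free_nonneg' (criticalBeta_nonneg 3) (hb 0) (hb 1)
    have hG23 : 0 ≤ boxG L (y 2) (y 3) := isingTwoPoint_free_nonneg' (criticalBeta_nonneg 3) (hb 2) (hb 3)
    have hP : κ ≤ twoCurrentMeet L (y 0) (y 1) (y 2) (y 3) := hL
    have hGG : 0 ≤ boxG L (y 0) (y 1) * boxG L (y 2) (y 3) := mul_nonneg hG01 hG23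
    have key := mul_le_mul_of_nonneg_left hP hGG
    unfold twoCurrentMeet at key
    unfold boxG at key hGG ⊢
    nlinarith [key, hGG]
  have hfin := le_of_tendsto_of_tendsto hB hU.neg hle
  -- rewrite the limit inequality in the Disproof's spelling
  have e01 : (![y 0, y 1] : Fin 2 → Site 3) = ![latticeApprox δ (x 0), latticeApprox δ (x 1)] := rfl
  have e23 : (![y 2, y 3] : Fin 2 → Site 3) = ![latticeApprox δ (x 2), latticeApprox δ (x 3)] := rfl
  rw [e01, e23] at hfin
  exact hfin

/-- Two pointwise limits with the SAME renormalisation have the same connected four-point function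
on non-coincident quadruples (uniqueness of limits along `𝓝[>] 0`). [folklore] -/
theorem limitConnectedFour_eq_of_limits {ρ : ℝ → ℝ} {S S' : CorrFamily 3}
    (hlim : HasPointwiseScalingLimit (criticalCorr 3) ρ S)
    (hlim' : HasPointwiseScalingLimit (criticalCorr 3) ρ S')
    {x : Fin 4 → EuclideanSpace ℝ (Fin 3)} (hx : x ∈ NonCoincident 3 4) :
    limitConnectedFour S x = limitConnectedFour S' x :=
  tendsto_nhds_unique (tendsto_rescaled_criticalUrsellFour hlim hx)
    (tendsto_rescaled_criticalUrsellFour hlim' hx)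

/-- Hence `HasNontrivialU4` transfers between two limits with the same `ρ`. [folklore] -/
theorem hasNontrivialU4_of_limits {ρ : ℝ → ℝ} {S S' : CorrFamily 3}
    (hlim : HasPointwiseScalingLimit (criticalCorr 3) ρ S)
    (hlim' : HasPointwiseScalingLimit (criticalCorr 3) ρ S') (h' : HasNontrivialU4 S') :
    HasNontrivialU4 S := by
  obtain ⟨x, hx, hne⟩ := h'
  exact ⟨x, hx, by rwa [limitConnectedFour_eq_of_limits hlim hlim' hx]⟩

/-- A NORMALISED family (zero off `NonCoincident`) that is scale covariant on non-coincident
configurations is scale covariant outright (dilations preserve injectivity). [folklore] -/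
theorem isScaleCovariant_of_scaleCovariantOn {Δ : ℝ} {S : CorrFamily 3}
    (hnorm : ∀ n z, z ∉ NonCoincident 3 n → S n z = 0) (hcov : ScaleCovariantOn Δ S) :
    IsScaleCovariant Δ S := by
  intro n c hc z
  by_cases hz : Function.Injective z
  · exact hcov n c hc z hz
  · have hz' : ¬ Function.Injective (fun i => c • z i) := fun h =>
      hz ((smul_right_injective (EuclideanSpace ℝ (Fin 3)) hc.ne').of_comp_iff z |>.1 h)
    rw [hnorm n _ hz', hnorm n z hz, mul_zero]

/-- **The lattice target suffices (the Disproof's §C.1 `of_latticeU4RatioPositive`, proof copied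
verbatim, sorry-free; stated per limit `S` rather than as the named crux so that the skeleton theorem
below is the ONLY theorem concluding the crux decl by name)**: for ANY non-degenerate pointwise limit
`S`, the rescaled lattice inequality passes to the limit (`tendsto_rescaled_criticalUrsellFour`) and
gives `U₄^S(x) ≤ −c S₂(x₀,x₁)S₂(x₂,x₃) < 0`. [cite: AizenmanDuminilCopinAnnals2021, eq. (3.11)] -/
theorem hasNontrivialU4_of_latticeU4RatioPositive (h : LatticeU4RatioPositive) {ρ : ℝ → ℝ}
    {S : CorrFamily 3} (hlim : HasPointwiseScalingLimit (criticalCorr 3) ρ S)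
    (hnd : IsNondegenerateTwoPoint S) : HasNontrivialU4 S := by
  obtain ⟨x, hx, c, hc, hev⟩ := h
  have hinj : Function.Injective x := hx
  have hpair : ∀ i j, i ≠ j → Tendsto
      (fun δ => ρ δ ^ 2 * criticalCorr 3 2 ![latticeApprox δ (x i), latticeApprox δ (x j)])
      (𝓝[>] 0) (𝓝 (S 2 ![x i, x j])) := by
    intro i j hij
    have hmem : (![x i, x j] : Fin 2 → EuclideanSpace ℝ (Fin 3)) ∈ NonCoincident 3 2 :=
      pair_mem_nonCoincident fun h => hij (hinj h)
    refine Tendsto.congr (fun δ => ?_) ((hlim 2).tendsto_at hmem)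
    rw [rescaledCorrelator_apply, latticeApprox_comp_two]
    rfl
  have hU : Tendsto (fun δ => ρ δ ^ 4 * latU4 δ x) (𝓝[>] 0) (𝓝 (limitConnectedFour S x)) :=
    tendsto_rescaled_criticalUrsellFour hlim hx
  have hB := (((hpair 0 1 (by decide)).mul (hpair 2 3 (by decide))).const_mul c)
  have hle : c * (S 2 ![x 0, x 1] * S 2 ![x 2, x 3]) ≤ - limitConnectedFour S x := by
    refine le_of_tendsto_of_tendsto hB hU.neg ?_
    filter_upwards [hev] with δ hδ
    have h4 : (0:ℝ) ≤ ρ δ ^ 4 := by positivity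
    have := mul_le_mul_of_nonneg_left hδ h4
    calc c * (ρ δ ^ 2 * criticalCorr 3 2 ![latticeApprox δ (x 0), latticeApprox δ (x 1)] *
          (ρ δ ^ 2 * criticalCorr 3 2 ![latticeApprox δ (x 2), latticeApprox δ (x 3)]))
        = ρ δ ^ 4 * (c * (criticalCorr 3 2 ![latticeApprox δ (x 0), latticeApprox δ (x 1)] *
          criticalCorr 3 2 ![latticeApprox δ (x 2), latticeApprox δ (x 3)])) := by ring
      _ ≤ ρ δ ^ 4 * (- latU4 δ x) := this
      _ = -(ρ δ ^ 4 * latU4 δ x) := by ring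
  have h01 : (![x 0, x 1] : Fin 2 → _) ∈ NonCoincident 3 2 :=
    pair_mem_nonCoincident fun h => absurd (hinj h) (by decide)
  have h23 : (![x 2, x 3] : Fin 2 → _) ∈ NonCoincident 3 2 :=
    pair_mem_nonCoincident fun h => absurd (hinj h) (by decide)
  have hpos : 0 < c * (S 2 ![x 0, x 1] * S 2 ![x 2, x 3]) :=
    mul_pos hc (mul_pos (hnd _ h01) (hnd _ h23))
  exact ⟨x, hx, by linarith⟩

/-! ## The composition: STUBS 1–3 + items 4739, 2601 ⇒ the crux, BY NAME -/

/-- **`IsingEuclidUpgradeR4NonGaussian` from STUBS 1–3, the limit normalisation (item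
stmt-CriticalPhenomena-4739 `WeylWindow.LimitNormalisation`, by name) and the anomalous branch (item
stmt-CriticalPhenomena-2601 `AnomalousForcesInteraction.GaussianLimitIsFree`, by name)** — THE
SKELETON THEOREM. Normalise `S ↦ S'` (same `ρ`, so `U₄^{S'} = U₄^S` on `NC`); Lamperti
(`exists_rpow_scale_mem_Icc`) gives the exponent `Δ ∈ [1/2,1]`; if `Δ < 3/4`, fat × thin
(`twoCurrentMeet_lower`) ⇒ `LatticeU4RatioPositive` ⇒ `HasNontrivialU4 S'` by
`hasNontrivialU4_of_latticeU4RatioPositive`; if `Δ ≥ 3/4`, a `U₄`-free `S'` would have `Δ = 1/2`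
by item 2601.
[cite: AizenmanDuminilCopinAnnals2021, eq. (3.11) and Lemma 4.4] -/
theorem IsingEuclidUpgradeR4NonGaussian_of
    (hnormalise : Summit.CriticalPhenomena.Ising3DConformalLimit.Theses.WeylWindow.LimitNormalisation)
    (hfree : Summit.CriticalPhenomena.Ising3DConformalLimit.Theses.AnomalousForcesInteraction.GaussianLimitIsFree) :
    Summit.CriticalPhenomena.Ising3DConformalLimit.Theses.HyperoctahedralRP.IsingEuclidUpgradeR4NonGaussian := by
  intro ρ S hρ hlim hnd
  obtain ⟨S', hlim', hnorm', hnd', hTI, -⟩ := hnormalise ρ S hρ hlim hnd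
  refine hasNontrivialU4_of_limits hlim hlim' ?_
  obtain ⟨Δ, hΔ, hcov⟩ := hlim'.exists_rpow_scale_mem_Icc hρ hnd'
  by_cases hlt : Δ < 3 / 4
  · -- `Δ < 3/4`: fat step × meeting robustness ⇒ lattice target ⇒ crux
    have hLat : LatticeU4RatioPositive :=
      latticeU4RatioPositive_of_twoCurrentMeet_lower (twoCurrentMeet_lower hρ hlim' hnd' hcov hlt)
    exact hasNontrivialU4_of_latticeU4RatioPositive hLat hlim' hnd'
  · -- `Δ ≥ 3/4`: the anomalous branch — a `U₄`-free limit would be free, `Δ = 1/2` (item 2601)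
    by_contra hG
    have hsc : IsScaleCovariant Δ S' := isScaleCovariant_of_scaleCovariantOn hnorm' hcov
    have hhalf : Δ = 1 / 2 := hfree ρ Δ S' hρ hlim' hnd' hTI hsc hG
    exact hlt (by rw [hhalf]; norm_num)

/-- The same composition concluding the copy `IsingEuclidUpgrade.IsingEuclidUpgradeR4NonGaussian`
(= the Disproof's `Crux`; the 25 route copies of item stmt-CriticalPhenomena-0636 are one term,
`Iff.rfl`). [folklore] -/
theorem IsingEuclidUpgradeR4NonGaussian_of_IsingEuclidUpgrade
    (hnormalise : Summit.CriticalPhenomena.Ising3DConformalLimit.Theses.WeylWindow.LimitNormalisation)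
    (hfree : Summit.CriticalPhenomena.Ising3DConformalLimit.Theses.AnomalousForcesInteraction.GaussianLimitIsFree) :
    Summit.CriticalPhenomena.Ising3DConformalLimit.Theses.IsingEuclidUpgrade.IsingEuclidUpgradeR4NonGaussian :=
  IsingEuclidUpgradeR4NonGaussian_of hnormalise hfree

/-- **MEAN-FIELD CALIBRATION (kernel-checked, items-free modulo STUBS 1–3)**: a non-degenerate limit
whose exponent is `< 3/4` — in particular any limit with `Δ = 1/2` (`η = 0`) — has `U₄ ≢ 0`. This is
the card's "MeanFieldBranch = four-current at `η = 0`" (triage r1-1 dependency note) and shows where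
item 2601 is and is not consumed. [cite: AizenmanDuminilCopinAnnals2021, Lemma 4.4] -/
theorem hasNontrivialU4_of_exponent_lt {ρ : ℝ → ℝ} {S : CorrFamily 3} {Δ : ℝ}
    (hρ : ∀ δ ∈ Set.Ioc (0:ℝ) 1, 0 < ρ δ) (hlim : HasPointwiseScalingLimit (criticalCorr 3) ρ S)
    (hnd : IsNondegenerateTwoPoint S) (hcov : ScaleCovariantOn Δ S) (hΔ : Δ < 3 / 4) :
    HasNontrivialU4 S :=
  hasNontrivialU4_of_latticeU4RatioPositive
    (latticeU4RatioPositive_of_twoCurrentMeet_lower (twoCurrentMeet_lower hρ hlim hnd hcov hΔ)) hlim hnd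

end Summit.CriticalPhenomena.Ising3DConformalLimit.Cruxes.IsingEuclidUpgradeR4NonGaussian.FourCurrentCosetRobustness

end
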